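import Mathlib.Analysis.Normed.Module.Alternating.Curry
import Mathlib.GroupTheory.Perm.Fin
import Mathlib.Analysis.InnerProductSpace.PiL2
import HarnessLib

/-!
# Block vectors of a product `ℝᵖ × ℝ^q` and the cone-step identities of alternating maps

Topic `Literature/LinearAlgebra/Alternating`. The linear algebra behind the evaluation of the
shuffle sum of integrals (Eilenberg–Zilber / de Rham cup product comparison,
`Literature/Geometry/Manifold/ShuffleFubini`): an alternating `n`-form on `X = ℝᵖ × ℝ^q`
(`p + q = n`) is fed the **standard block frame** `stdBlock = ((e₀,0),…,(e_{p-1},0),(0,e'₀),…,(0,e'_{q-1}))`,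
and the cone recursion of the shuffle simplices replaces this frame, at the next stage
`(p+1, q)` (a first right-step) or `(p, q+1)` (a first up-step), by

* right-step: `(cR s', LR t (stdBlock p q))` with `cR s' = (e₀, s'₀ e'₀)` and
  `LR t (u, u') = ((0,u), (t u'₀, u'_{≥1}))`;
* up-step: `(cU s, LU t (stdBlock p q))` with `cU s = (s₀ e₀, e'₀)` and `LU t (u,u') = ((t u₀, u_{≥1}), (0,u'))`.

For an alternating `(n+1)`-form `f` we prove (`map_consR_succ`, `map_consR_zero`, `map_consU_succ`,
`map_consU_zero`)

`f (cR s', LR t ∘ stdBlock p (q'+1)) = t • f (stdBlock (p+1) (q'+1))`,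
`f (cU s, LU t ∘ stdBlock (p'+1) q) = ((-1)^{p'+1} t) • f (stdBlock (p'+1) (q+1))`,

and the degenerate versions without the factor `t` when the scaled factor is absent (`q = 0`,
resp. `p = 0`): multilinearity pulls out the scalar `t`, the alternating property kills the
`s'₀ e'₀` (resp. `s₀ e₀`) correction, and in the up-step the frame is the block frame permuted by
the cycle `(0 1 … p'+1)` of sign `(-1)^{p'+1}` (`Fin.sign_cycleRange`). The sign `(-1)^{p'+1}` is
exactly the sign of an initial up-step in the shuffle chains
(`…SingularHomology.ShuffleChains.shuffle_succ_succ`). Also: the continuous linear packaging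
`LRL`, `LUL` and the affine cone maps `hR t x = (t, LR t x)`-style decompositions (`hR_eq`, `hU_eq`)
used for the derivative computations of the sequel.

Everything is proved; no named facts.

## References

* S. Eilenberg, S. Mac Lane, On the groups `H(Π,n)`. I, Ann. of Math. 58 (1953), §5. [folklore attribution]
-/

noncomputable section

open Function

namespace Literature.LinearAlgebra.Alternating

/-! ### Generic facts on continuous alternating maps -/

section Generic

variable {ι : Type*} {M : Type*} [NormedAddCommGroup M] [NormedSpace ℝ M]
  {N : Type*} [NormedAddCommGroup N] [NormedSpace ℝ N] (f : M [⋀^ι]→L[ℝ] N)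

/-- `(0, 0, …, 0)` in `cons` form. [folklore] -/
theorem cons_zero_zero (p : ℕ) : (Fin.cons 0 0 : Fin (p + 1) → ℝ) = 0 := by
  funext j
  exact Fin.cases rfl (fun _ ↦ rfl) j

/-- Adding to one argument a multiple of another argument does not change the value of an
alternating map. [folklore] -/
theorem map_update_add_smul_of_ne [DecidableEq ι] (v : ι → M) {i j : ι} (hij : i ≠ j) (c : ℝ) :
    f (update v i (v i + c • v j)) = f v := by
  rw [f.map_update_add, f.map_update_smul, update_eq_self]
  have : f (update v i (v j)) = 0 := by
    have := f.toAlternatingMap.map_update_self v hij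
    simpa using this
  rw [this, smul_zero, add_zero]

/-- Permuting the arguments multiplies the value by the sign. [folklore] -/
theorem map_comp_perm [DecidableEq ι] [Fintype ι] (v : ι → M) (σ : Equiv.Perm ι) : f (v ∘ σ) = (Equiv.Perm.sign σ : ℤ) • f v := by
  have := f.toAlternatingMap.map_perm v σ
  simpa [Units.smul_def] using this

/-- Two equal arguments give zero. [folklore] -/
theorem map_eq_zero_of_eq' (v : ι → M) {i j : ι} (h : v i = v j) (hij : i ≠ j) : f v = 0 :=
  f.map_eq_zero_of_eq v h hij

end Generic

/-! ### Block vectors and the cone-step maps -/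

/-- The space `ℝᵖ × ℝ^q`. [folklore] -/
abbrev X (p q : ℕ) : Type := (Fin p → ℝ) × (Fin q → ℝ)

/-- **The standard block frame** of `ℝᵖ × ℝ^q` indexed by `Fin n`, `p + q = n`:
`i < p ↦ (eᵢ, 0)`, `i = p + j ↦ (0, e'ⱼ)`. [folklore] -/
def stdBlock (p q n : ℕ) (h : p + q = n) (i : Fin n) : X p q :=
  if hi : (i : ℕ) < p then (Pi.single ⟨i, hi⟩ 1, 0) else (0, Pi.single ⟨i - p, by omega⟩ 1)

/-- The horizontal block vectors `(eᵢ, 0)`, `i < p`. [folklore] -/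
theorem stdBlock_of_lt {p q n : ℕ} (h : p + q = n) {i : Fin n} (hi : (i : ℕ) < p) :
    stdBlock p q n h i = (Pi.single ⟨i, hi⟩ 1, 0) := dif_pos hi

/-- The vertical block vectors `(0, e'ⱼ)`, `i = p + j`. [folklore] -/
theorem stdBlock_of_le {p q n : ℕ} (h : p + q = n) {i : Fin n} (hi : p ≤ (i : ℕ)) :
    stdBlock p q n h i = (0, Pi.single ⟨i - p, by omega⟩ 1) := dif_neg (Nat.not_lt.mpr hi)

/-- Scaling the first coordinate: `(t u₀, u₁, …)`. [folklore] -/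
def scaleFirst {q : ℕ} (t : ℝ) (u : Fin q → ℝ) : Fin q → ℝ := fun j ↦ if (j : ℕ) = 0 then t * u j else u j

/-- Unfolding `scaleFirst`. [folklore] -/
theorem scaleFirst_apply {q : ℕ} (t : ℝ) (u : Fin q → ℝ) (j : Fin q) :
    scaleFirst t u j = if (j : ℕ) = 0 then t * u j else u j := rfl

/-- `scaleFirst` in `cons` form. [folklore] -/
theorem scaleFirst_cons {q : ℕ} (t a : ℝ) (u : Fin q → ℝ) :
    scaleFirst t (Fin.cons a u : Fin (q + 1) → ℝ) = Fin.cons (t * a) u := by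
  funext j
  refine Fin.cases (by simp [scaleFirst]) (fun j' ↦ ?_) j
  simp [scaleFirst]

/-- `scaleFirst t` as a continuous linear map. [folklore] -/
def scaleFirstL (q : ℕ) (t : ℝ) : (Fin q → ℝ) →L[ℝ] (Fin q → ℝ) :=
  LinearMap.toContinuousLinearMap
    { toFun := scaleFirst t
      map_add' := fun u v ↦ by funext j; simp only [scaleFirst_apply, Pi.add_apply]; split_ifs <;> ring
      map_smul' := fun c u ↦ by funext j; simp only [scaleFirst_apply, Pi.smul_apply, smul_eq_mul, RingHom.id_apply]; split_ifs <;> ring }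

/-- `scaleFirstL` is `scaleFirst`. [folklore] -/
@[simp] theorem scaleFirstL_apply (q : ℕ) (t : ℝ) (u : Fin q → ℝ) : scaleFirstL q t u = scaleFirst t u := rfl

/-- `u ↦ (0, u)` as a continuous linear map `ℝᵖ → ℝᵖ⁺¹`. [folklore] -/
def consZeroL (p : ℕ) : (Fin p → ℝ) →L[ℝ] (Fin (p + 1) → ℝ) :=
  LinearMap.toContinuousLinearMap
    { toFun := fun u ↦ (Fin.cons 0 u : Fin (p + 1) → ℝ)
      map_add' := fun u v ↦ by funext j; refine Fin.cases (by simp) (fun j' ↦ by simp) j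
      map_smul' := fun c u ↦ by funext j; refine Fin.cases (by simp) (fun j' ↦ by simp) j }

/-- `consZeroL` is `Fin.cons 0`. [folklore] -/
@[simp] theorem consZeroL_apply (p : ℕ) (u : Fin p → ℝ) : consZeroL p u = Fin.cons 0 u := rfl

/-- **Right-step frame map** `LR t (u, u') = ((0, u), (t u'₀, u'_{≥1}))`. [folklore] -/
def LRL (p q : ℕ) (t : ℝ) : X p q →L[ℝ] X (p + 1) q :=
  ((consZeroL p).comp (ContinuousLinearMap.fst ℝ _ _)).prod ((scaleFirstL q t).comp (ContinuousLinearMap.snd ℝ _ _))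

/-- Unfolding the right-step frame map. [folklore] -/
@[simp] theorem LRL_apply (p q : ℕ) (t : ℝ) (v : X p q) : LRL p q t v = (Fin.cons 0 v.1, scaleFirst t v.2) := rfl

/-- **Up-step frame map** `LU t (u, u') = ((t u₀, u_{≥1}), (0, u'))`. [folklore] -/
def LUL (p q : ℕ) (t : ℝ) : X p q →L[ℝ] X p (q + 1) :=
  ((scaleFirstL p t).comp (ContinuousLinearMap.fst ℝ _ _)).prod ((consZeroL q).comp (ContinuousLinearMap.snd ℝ _ _))

/-- Unfolding the up-step frame map. [folklore] -/
@[simp] theorem LUL_apply (p q : ℕ) (t : ℝ) (v : X p q) : LUL p q t v = (scaleFirst t v.1, Fin.cons 0 v.2) := rfl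

/-- The extra first argument after a right-step: `cR s' = (e₀, s'₀ e'₀)`. [folklore] -/
def cR (p q : ℕ) (s' : Fin q → ℝ) : X (p + 1) q := (Pi.single 0 1, fun j ↦ if (j : ℕ) = 0 then s' j else 0)

/-- The extra first argument after an up-step: `cU s = (s₀ e₀, e'₀)`. [folklore] -/
def cU (p q : ℕ) (s : Fin p → ℝ) : X p (q + 1) := (fun a ↦ if (a : ℕ) = 0 then s a else 0, Pi.single 0 1)

/-- The right-step cone map `hR t (s, s') = ((t, s), (t s'₀, s'_{≥1}))`. [folklore] -/
def hR (p q : ℕ) (t : ℝ) (x : X p q) : X (p + 1) q := (Fin.cons t x.1, scaleFirst t x.2)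

/-- The up-step cone map `hU t (s, s') = ((t s₀, s_{≥1}), (t, s'))`. [folklore] -/
def hU (p q : ℕ) (t : ℝ) (x : X p q) : X p (q + 1) := (scaleFirst t x.1, Fin.cons t x.2)

/-- The right-step cone map is the frame map plus a constant. [folklore] -/
theorem hR_eq (p q : ℕ) (t : ℝ) (x : X p q) : hR p q t x = (Fin.cons t 0, 0) + LRL p q t x := by
  simp only [hR, LRL_apply, Prod.mk_add_mk, zero_add, Prod.mk.injEq, and_true]
  funext j
  refine Fin.cases (by simp) (fun j' ↦ by simp) j

/-- The up-step cone map is the frame map plus a constant. [folklore] -/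
theorem hU_eq (p q : ℕ) (t : ℝ) (x : X p q) : hU p q t x = (0, Fin.cons t 0) + LUL p q t x := by
  simp only [hU, LUL_apply, Prod.mk_add_mk, zero_add, Prod.mk.injEq, true_and]
  funext j
  refine Fin.cases (by simp) (fun j' ↦ by simp) j

/-- The right-step cone map is continuous (affine). [folklore] -/
theorem continuous_hR (p q : ℕ) (t : ℝ) : Continuous (hR p q t) := by
  have : hR p q t = fun x ↦ (Fin.cons t 0, 0) + LRL p q t x := funext (hR_eq p q t)
  rw [this]
  exact continuous_const.add (LRL p q t).continuous

/-- The up-step cone map is continuous (affine). [folklore] -/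
theorem continuous_hU (p q : ℕ) (t : ℝ) : Continuous (hU p q t) := by
  have : hU p q t = fun x ↦ (0, Fin.cons t 0) + LUL p q t x := funext (hU_eq p q t)
  rw [this]
  exact continuous_const.add (LUL p q t).continuous

/-- `(0, eₐ) = e_{a+1}` in `cons` form. [folklore] -/
theorem cons_zero_single {p : ℕ} (a : Fin p) : (Fin.cons 0 (Pi.single a 1) : Fin (p + 1) → ℝ) = Pi.single a.succ 1 := by
  funext j
  refine Fin.cases (by simp) (fun j' ↦ ?_) j
  simp [Pi.single_apply, Fin.succ_inj]

/-- `scaleFirst t eⱼ = t^{[j = 0]} eⱼ`. [folklore] -/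
theorem scaleFirst_single {q : ℕ} (t : ℝ) (j : Fin q) :
    scaleFirst t (Pi.single j 1) = (if (j : ℕ) = 0 then t else 1) • (Pi.single j 1 : Fin q → ℝ) := by
  funext i
  simp only [scaleFirst_apply, Pi.smul_apply, Pi.single_apply, smul_eq_mul]
  by_cases hij : i = j
  · subst hij; split_ifs <;> simp
  · simp [hij]

/-! ### The cone-step identities -/

section Identities

variable {N : Type*} [NormedAddCommGroup N] [NormedSpace ℝ N]

/-- **Right-step, positive `q`**: for an alternating `(n+1)`-form `f` on `ℝᵖ⁺¹ × ℝ^{q'+1}` and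
`p + (q'+1) = n`,
`f (cR s', LR t ∘ stdBlock p (q'+1)) = t • f (stdBlock (p+1) (q'+1))`. [folklore] -/
theorem map_consR_succ {p q' n : ℕ} (h : p + (q' + 1) = n) (h' : p + 1 + (q' + 1) = n + 1)
    (f : X (p + 1) (q' + 1) [⋀^Fin (n + 1)]→L[ℝ] N) (t : ℝ) (s' : Fin (q' + 1) → ℝ) :
    f (Fin.cons (cR p (q' + 1) s') fun i ↦ LRL p (q' + 1) t (stdBlock p (q' + 1) n h i)) =
      t • f (stdBlock (p + 1) (q' + 1) (n + 1) h') := by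
  classical
  set u : Fin (n + 1) → X (p + 1) (q' + 1) := stdBlock (p + 1) (q' + 1) (n + 1) h' with hu
  -- the index of the first vertical vector `(0, e'₀)`
  set P : Fin (n + 1) := ⟨p + 1, by omega⟩ with hP
  set d : Fin (n + 1) → ℝ := fun i ↦ if i = P then t else 1 with hd
  set D : Fin (n + 1) → X (p + 1) (q' + 1) := fun i ↦ d i • u i with hD
  have hd_apply : ∀ i, d i = if i = P then t else 1 := fun i ↦ by rw [hd]
  have hD_apply : ∀ i, D i = d i • u i := fun i ↦ by rw [hD]
  have hP0 : (P : Fin (n + 1)) ≠ 0 := fun h0 ↦ by have := congrArg Fin.val h0; simp [hP] at this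
  have huP : u P = (0, Pi.single 0 1) := by
    rw [hu, stdBlock_of_le h' (by simp [hP])]
    congr 2
    exact Fin.ext (by simp [hP])
  have hu0 : u 0 = (Pi.single 0 1, 0) := by
    rw [hu, stdBlock_of_lt h' (by simp)]
    rfl
  -- the argument vector is `update D 0 (u 0 + s'₀ • u P)`
  have hvec : (Fin.cons (cR p (q' + 1) s') fun i ↦ LRL p (q' + 1) t (stdBlock p (q' + 1) n h i)) =
      update D 0 (u 0 + s' 0 • u P) := by
    funext i
    refine Fin.cases ?_ (fun a ↦ ?_) i
    · rw [Fin.cons_zero, update_self, hu0, huP, cR]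
      ext j
      · simp
      · simp only [Prod.snd_add, Pi.add_apply, Prod.smul_snd, Pi.smul_apply, Pi.single_apply, smul_eq_mul,
          mul_ite, mul_one, mul_zero, Pi.zero_apply, zero_add]
        by_cases hj : j = 0
        · subst hj; simp
        · have hj' : ¬((j : ℕ) = 0) := fun h0 ↦ hj (Fin.ext h0)
          simp [hj, hj']
    · rw [Fin.cons_succ, update_of_ne (Fin.succ_ne_zero a), hD_apply, hd_apply, hu]
      by_cases ha : (a : ℕ) < p
      · rw [stdBlock_of_lt h ha, stdBlock_of_lt h' (by simp; omega), LRL_apply, if_neg]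
        · simp only [one_smul, Prod.mk.injEq]
          refine ⟨?_, by funext j; simp [scaleFirst]⟩
          rw [cons_zero_single]
          congr 1
        · intro hAP; have := congrArg Fin.val hAP; simp [hP] at this; omega
      · rw [stdBlock_of_le h (Nat.not_lt.mp ha), stdBlock_of_le h' (by simp; omega), LRL_apply, scaleFirst_single,
          cons_zero_zero]
        have hidx : (⟨(a.succ : ℕ) - (p + 1), by simp; omega⟩ : Fin (q' + 1)) = ⟨(a : ℕ) - p, by omega⟩ :=
          Fin.ext (by simp)
        rw [hidx]
        by_cases hap : (a : ℕ) = p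
        · rw [if_pos (show ((⟨(a : ℕ) - p, _⟩ : Fin (q' + 1)) : ℕ) = 0 by simp [hap]), if_pos]
          · simp only [Prod.smul_mk, smul_zero]
          · exact Fin.ext (by simp [hP, hap])
        · rw [if_neg (show ¬((⟨(a : ℕ) - p, _⟩ : Fin (q' + 1)) : ℕ) = 0 by simp; omega), if_neg]
          · simp only [one_smul]
          · intro hAP; have := congrArg Fin.val hAP; simp [hP] at this; omega
  rw [hvec, f.map_update_add, f.map_update_smul]
  -- first term: `update D 0 (u 0) = D`, and `f D = (∏ d) • f u = t • f u`
  have hD0 : update D 0 (u 0) = D := by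
    funext i
    rcases eq_or_ne i 0 with rfl | hi
    · rw [update_self, hD_apply, hd_apply, if_neg hP0.symm, one_smul]
    · rw [update_of_ne hi]
  have hprod : ∏ i, d i = t := by
    rw [Finset.prod_eq_single P (fun i _ hi ↦ by rw [hd_apply, if_neg hi]) (fun hP' ↦ absurd (Finset.mem_univ P) hP'),
      hd_apply, if_pos rfl]
  have hfD : f D = t • f u := by
    rw [hD, f.map_smul_univ, hprod]
  -- second term: arguments `0` and `P` both multiples of `u P`
  have hzero : f (update D 0 (u P)) = 0 := by
    set Y := update D 0 (u P) with hY
    have hYP : Y P = t • u P := by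
      rw [hY, update_of_ne hP0, hD_apply, hd_apply, if_pos rfl]
    have h1 : f Y = t • f (update Y P (u P)) := by
      conv_lhs => rw [← update_eq_self P Y, hYP]
      rw [f.map_update_smul]
    have h2 : f (update Y P (u P)) = 0 :=
      f.map_eq_zero_of_eq _ (by rw [update_self, update_of_ne hP0.symm, hY, update_self]) hP0.symm
    rw [h1, h2, smul_zero]
  rw [hD0, hfD, hzero, smul_zero, add_zero]

/-- **Right-step, `q = 0`**: the frame `(cR s', LR t ∘ stdBlock p 0)` IS the block frame
`stdBlock (p+1) 0`. [folklore] -/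
theorem map_consR_zero {p n : ℕ} (h : p + 0 = n) (h' : p + 1 + 0 = n + 1)
    (f : X (p + 1) 0 [⋀^Fin (n + 1)]→L[ℝ] N) (t : ℝ) (s' : Fin 0 → ℝ) :
    f (Fin.cons (cR p 0 s') fun i ↦ LRL p 0 t (stdBlock p 0 n h i)) = f (stdBlock (p + 1) 0 (n + 1) h') := by
  congr 1
  funext i
  refine Fin.cases ?_ (fun a ↦ ?_) i
  · rw [Fin.cons_zero, stdBlock_of_lt h' (by simp), cR]
    ext j
    · rfl
    · exact j.elim0
  · rw [Fin.cons_succ, stdBlock_of_lt h (by omega), stdBlock_of_lt h' (by simp; omega), LRL_apply]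
    ext j
    · simp only [cons_zero_single]
      congr 2
    · exact j.elim0

/-- **Up-step, positive `p`**: for an alternating `(n+1)`-form `f` on `ℝ^{p'+1} × ℝ^{q+1}` and
`(p'+1) + q = n`,
`f (cU s, LU t ∘ stdBlock (p'+1) q) = ((-1)^{p'+1} t) • f (stdBlock (p'+1) (q+1))`. [folklore] -/
theorem map_consU_succ {p' q n : ℕ} (h : p' + 1 + q = n) (h' : p' + 1 + (q + 1) = n + 1)
    (f : X (p' + 1) (q + 1) [⋀^Fin (n + 1)]→L[ℝ] N) (t : ℝ) (s : Fin (p' + 1) → ℝ) :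
    f (Fin.cons (cU (p' + 1) q s) fun i ↦ LUL (p' + 1) q t (stdBlock (p' + 1) q n h i)) =
      ((-1 : ℝ) ^ (p' + 1) * t) • f (stdBlock (p' + 1) (q + 1) (n + 1) h') := by
  classical
  set u : Fin (n + 1) → X (p' + 1) (q + 1) := stdBlock (p' + 1) (q + 1) (n + 1) h' with hu
  -- the index of the first vertical vector `(0, e'₀)`, the index `1`, and the cycle moving `P` to the front
  set P : Fin (n + 1) := ⟨p' + 1, by omega⟩ with hP
  set I1 : Fin (n + 1) := ⟨1, by omega⟩ with hI1
  set π : Equiv.Perm (Fin (n + 1)) := (Fin.cycleRange P).symm with hπ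
  have hP0 : (P : Fin (n + 1)) ≠ 0 := fun h0 ↦ by have := congrArg Fin.val h0; simp [hP] at this
  have h10 : (I1 : Fin (n + 1)) ≠ 0 := fun h0 ↦ by have := congrArg Fin.val h0; simp [hI1] at this
  have hπ0 : π 0 = P := by
    rw [hπ, Equiv.symm_apply_eq]; exact (Fin.cycleRange_self P).symm
  have hπsucc_le : ∀ a : Fin n, (a : ℕ) ≤ p' → π a.succ = a.castSucc := fun a ha ↦ by
    rw [hπ, Equiv.symm_apply_eq, Fin.cycleRange_of_lt]
    · exact Fin.ext (by simp)
    · rw [Fin.lt_def]; simp [hP]; omega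
  have hπsucc_gt : ∀ a : Fin n, p' < (a : ℕ) → π a.succ = a.succ := fun a ha ↦ by
    rw [hπ, Equiv.symm_apply_eq, Fin.cycleRange_of_gt]
    rw [Fin.lt_def]; simp [hP]; omega
  have hπ1 : π I1 = 0 := by
    have := hπsucc_le ⟨0, by omega⟩ (Nat.zero_le _)
    rw [show (⟨0, by omega⟩ : Fin n).succ = I1 from Fin.ext rfl] at this
    rw [this]
    exact Fin.ext rfl
  set d : Fin (n + 1) → ℝ := fun i ↦ if i = I1 then t else 1 with hd
  set W : Fin (n + 1) → X (p' + 1) (q + 1) := fun i ↦ d i • u (π i) with hW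
  have hd_apply : ∀ i, d i = if i = I1 then t else 1 := fun i ↦ by rw [hd]
  have hW_apply : ∀ i, W i = d i • u (π i) := fun i ↦ by rw [hW]
  have huP : u P = (0, Pi.single 0 1) := by
    rw [hu, stdBlock_of_le h' (by simp [hP])]
    congr 2
    exact Fin.ext (by simp [hP])
  have hu0 : u 0 = (Pi.single 0 1, 0) := by
    rw [hu, stdBlock_of_lt h' (by simp)]
    rfl
  -- the argument vector is `update W 0 (u P + s₀ • u 0)`
  have hvec : (Fin.cons (cU (p' + 1) q s) fun i ↦ LUL (p' + 1) q t (stdBlock (p' + 1) q n h i)) =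
      update W 0 (u P + s 0 • u 0) := by
    funext i
    refine Fin.cases ?_ (fun a ↦ ?_) i
    · rw [Fin.cons_zero, update_self, hu0, huP, cU]
      ext j
      · simp only [Prod.fst_add, Pi.add_apply, Pi.zero_apply, Prod.smul_fst, Pi.smul_apply, Pi.single_apply,
          smul_eq_mul, mul_ite, mul_one, mul_zero, zero_add]
        by_cases hj : j = 0
        · subst hj; simp
        · have hj' : ¬((j : ℕ) = 0) := fun h0 ↦ hj (Fin.ext h0)
          simp [hj, hj']
      · simp
    · rw [Fin.cons_succ, update_of_ne (Fin.succ_ne_zero a), hW_apply, hd_apply, hu]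
      by_cases ha : (a : ℕ) ≤ p'
      · rw [hπsucc_le a ha, stdBlock_of_lt h (by omega), stdBlock_of_lt h' (by simp; omega), LUL_apply,
          scaleFirst_single, cons_zero_zero]
        have hidx : (⟨(a.castSucc : ℕ), by simp; omega⟩ : Fin (p' + 1)) = ⟨(a : ℕ), by omega⟩ := Fin.ext (by simp)
        rw [hidx]
        by_cases ha0 : (a : ℕ) = 0
        · rw [if_pos (show ((⟨(a : ℕ), _⟩ : Fin (p' + 1)) : ℕ) = 0 from ha0), if_pos (Fin.ext (by simp [hI1, ha0]))]
          simp only [Prod.smul_mk, smul_zero]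
        · rw [if_neg (show ¬((⟨(a : ℕ), _⟩ : Fin (p' + 1)) : ℕ) = 0 from ha0), if_neg]
          · simp only [one_smul]
          · intro h1; have := congrArg Fin.val h1; simp [hI1] at this; omega
      · rw [not_le] at ha
        rw [hπsucc_gt a ha, stdBlock_of_le h (by omega), stdBlock_of_le h' (by simp; omega), LUL_apply, if_neg]
        · simp only [one_smul, Prod.mk.injEq]
          refine ⟨by funext j; simp [scaleFirst], ?_⟩
          rw [cons_zero_single]
          congr 1
          exact Fin.ext (by simp; omega)
        · intro h1; have := congrArg Fin.val h1; simp [hI1] at this; omega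
  rw [hvec, f.map_update_add, f.map_update_smul]
  -- first term: `update W 0 (u P) = W` and `f W = t • sign π • f u`
  have hW0 : update W 0 (u P) = W := by
    funext i
    rcases eq_or_ne i 0 with rfl | hi
    · rw [update_self, hW_apply, hd_apply, hπ0, if_neg h10.symm, one_smul]
    · rw [update_of_ne hi]
  have hprod : ∏ i, d i = t := by
    rw [Finset.prod_eq_single I1 (fun i _ hi ↦ by rw [hd_apply, if_neg hi]) (fun h1 ↦ absurd (Finset.mem_univ _) h1),
      hd_apply, if_pos rfl]
  have hsign : ((Equiv.Perm.sign π : ℤˣ) : ℤ) = (-1 : ℤ) ^ (p' + 1) := by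
    rw [hπ, ← Equiv.Perm.inv_def, Equiv.Perm.sign_inv, Fin.sign_cycleRange, Units.val_pow_eq_pow_val, Units.val_neg,
      Units.val_one]
  have hfW : f W = ((-1 : ℝ) ^ (p' + 1) * t) • f u := by
    rw [hW, f.map_smul_univ, hprod, show (fun i ↦ u (π i)) = u ∘ π from rfl, map_comp_perm f u π, hsign,
      ← Int.cast_smul_eq_zsmul ℝ, Int.cast_pow, Int.cast_neg, Int.cast_one, smul_smul, mul_comm]
  -- second term: arguments `0` and `I1` both multiples of `u 0`
  have hzero : f (update W 0 (u 0)) = 0 := by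
    set Y := update W 0 (u 0) with hY
    have hY1 : Y I1 = t • u 0 := by
      rw [hY, update_of_ne h10, hW_apply, hd_apply, hπ1, if_pos rfl]
    have h1 : f Y = t • f (update Y I1 (u 0)) := by
      conv_lhs => rw [← update_eq_self I1 Y, hY1]
      rw [f.map_update_smul]
    have h2 : f (update Y I1 (u 0)) = 0 :=
      f.map_eq_zero_of_eq _ (by rw [update_self, update_of_ne h10.symm, hY, update_self]) h10.symm
    rw [h1, h2, smul_zero]
  rw [hW0, hfW, hzero, smul_zero, add_zero]

/-- **Up-step, `p = 0`**: the frame `(cU s, LU t ∘ stdBlock 0 q)` IS the block frame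
`stdBlock 0 (q+1)`. [folklore] -/
theorem map_consU_zero {q n : ℕ} (h : 0 + q = n) (h' : 0 + (q + 1) = n + 1)
    (f : X 0 (q + 1) [⋀^Fin (n + 1)]→L[ℝ] N) (t : ℝ) (s : Fin 0 → ℝ) :
    f (Fin.cons (cU 0 q s) fun i ↦ LUL 0 q t (stdBlock 0 q n h i)) = f (stdBlock 0 (q + 1) (n + 1) h') := by
  congr 1
  funext i
  refine Fin.cases ?_ (fun a ↦ ?_) i
  · rw [Fin.cons_zero, stdBlock_of_le h' (Nat.zero_le _), cU]
    ext j
    · exact j.elim0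
    · simp
  · rw [Fin.cons_succ, stdBlock_of_le h (Nat.zero_le _), stdBlock_of_le h' (Nat.zero_le _), LUL_apply]
    ext j
    · exact j.elim0
    · simp only [Nat.sub_zero, Fin.val_succ, cons_zero_single]
      congr 2

end Identities

end Literature.LinearAlgebra.Alternating
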